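import Summits.BirchSwinnertonDyer.BirchSwinnertonDyer.Theorems.ErratumRoadFiveSigmaLocalMultRank
import HarnessLib

/-!
# (S5) at the MULTIPLICATIVE places: `charpoly Lt = X ∓ 1/q_w` for the dual Frobenius on
# `H¹(I_w, E[p^∞])^∨ ⧸ tors` (theorems only)

Cell `bsd-stepL`, K2 route `ErratumRoadFive`, support item 20495 `JSWSigmaLocalCharIdeal`, step (S5) at
the finitely decomposed places of MULTIPLICATIVE reduction; seat `bsd-stepL-imc-p1` (g14). THEOREMS ONLY.

Chain: the typer lane's coinvariant evaluation isomorphism `H¹(I_w, A) ≃ A ⧸ (ρτ − 1)A = A ⧸ D`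
(`exists_tame_generator_continuousCohomology_absInertia`, `range_sub_one_eq_span`, p581450 ∕ p581979 ∕ p582402)
with its Frobenius clause `q • ē(φ·c) = ρ̄(φ)(ē c)` (`residueFieldCard_nsmul_equiv_conjMap_coinvariants`);
the unipotence `hP` of inertia on `E[p^∞]` at a multiplicative place (`primaryTorsionGaloisRep_inertia_smul_sub_eq`);
`T_p(ρ̄(φ)) = ε` and `T_p Q ≠ 0` (`ErratumRoadFiveSigmaLocalMultQuotient`); `rank T_p Q = 1` (§2 here, from
`dim (V_pE)_{I} ≤ 1` by rank–nullity over `ℚ_p`); the Tate-module bridge (p576676). Result: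
`charpoly Lt = X − C(ε q_w⁻¹)`, `ε = +1` split ∕ `−1` non-split, whence the Euler-factor membership of `hS5`.

References: [GreenbergVatsal2000] §2, Prop. 2.4 and proof (arXiv p. 22); [Skinner2016PacificMC] §2.3 (p. 180);
[SilvermanATAEC1994] Thm. V.5.3, Ex. 5.11 (b), 5.13.
-/

noncomputable section

open scoped Classical TensorProduct
open Polynomial Field NumberField IsDedekindDomain WeierstrassCurve Module
open Literature.NumberTheory.EllipticCurves Literature.NumberTheory.GaloisRepresentations
  Literature.NumberTheory.EllipticCurves.BigGaloisRep
  Literature.NumberTheory.GaloisRepresentations.IsNonarchimedeanLocalField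
  Literature.NumberTheory.EllipticCurves.JetchevSkinnerWan2017 Literature.NumberTheory.EllipticCurves.IwasawaCharacter

set_option autoImplicit false
-- the Theorems namespace of this sub repeats the summit name by design (D-0017 nested layout)
set_option linter.dupNamespace false

namespace Summit.BirchSwinnertonDyer.BirchSwinnertonDyer.Theorems.SigmaLocal

open _root_.TopRep _root_.ContinuousCohomology

section Mult

variable {K : Type} [Field K] [NumberField K] (E : WeierstrassCurve K) [E.IsElliptic]
  (p : ℕ) [Fact p.Prime] {w : HeightOneSpectrum (𝓞 K)}

/-! ### The characteristic polynomial at a multiplicative place -/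

/-- **(S5) at a MULTIPLICATIVE place.** For `E` elliptic over a number field `K`, `w ∤ p` of multiplicative
reduction, a Frobenius `φ` of `K_w`, `ε = 1` (split) ∕ `−1` (non-split) and `n` the unit `q_w`: the dual
Frobenius `Lt` on `H¹(I_w, E[p^∞])^∨ ⧸ tors` has `charpoly Lt = X − C(ε n⁻¹)`. Chain: Tate-module bridge
(`charpoly Lt = charpoly T_p(φ·)`), the coinvariant evaluation isomorphism `H¹(I_w, E[p^∞]) ≃ E[p^∞] ⧸ D` and
its Frobenius clause (typer lane), `T_p(ρ̄(φ)) = ε` and `rank T_p(E[p^∞] ⧸ D) = 1`.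
[cite: GreenbergVatsal2000, §2, proof of Prop. 2.4 (arXiv p. 22)] [cite: SilvermanATAEC1994, Thm. V.5.3, Ex. 5.13] -/
theorem charpoly_quotientTorsion_dual_eq_of_hasMultiplicativeReductionAt
    (hw : ((p : ℕ) : 𝓞 K) ∉ w.asIdeal) (hv : E.HasMultiplicativeReductionAt w)
    {φ : absoluteGaloisGroup (w.adicCompletion K)} (hφ : IsFrobPow φ 1)
    [ContinuousSMul ℤ_[p] (PrimaryTorsion (geomPoints E) p)]
    [(absInertia (w.adicCompletion K)).Normal]
    [Module.Finite ℤ_[p] (CharacterModule (continuousCohomology 1 (subgroupRep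
        (((E.primaryTorsionGaloisRep p).restrict (localMap K (Sum.inl w)) :
        ContinuousRep (absoluteGaloisGroup (w.adicCompletion K)) ℤ_[p] (PrimaryTorsion (geomPoints E) p))).toTopRep (absInertia (w.adicCompletion K)))))]
    {ε : ℤ_[p]} (hε : (E.HasSplitMultiplicativeReductionAt w ∧ ε = 1) ∨
      (¬ E.HasSplitMultiplicativeReductionAt w ∧ ε = -1))
    (n : ℤ_[p]ˣ) (hn : (n : ℤ_[p]) = residueFieldCard (w.adicCompletion K))
    (Lt : (CharacterModule (continuousCohomology 1 (subgroupRep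
        (((E.primaryTorsionGaloisRep p).restrict (localMap K (Sum.inl w)) :
        ContinuousRep (absoluteGaloisGroup (w.adicCompletion K)) ℤ_[p] (PrimaryTorsion (geomPoints E) p))).toTopRep (absInertia (w.adicCompletion K)))) ⧸ Submodule.torsion ℤ_[p] (CharacterModule (continuousCohomology 1 (subgroupRep
        (((E.primaryTorsionGaloisRep p).restrict (localMap K (Sum.inl w)) :
        ContinuousRep (absoluteGaloisGroup (w.adicCompletion K)) ℤ_[p] (PrimaryTorsion (geomPoints E) p))).toTopRep (absInertia (w.adicCompletion K)))))) →ₗ[ℤ_[p]]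
      (CharacterModule (continuousCohomology 1 (subgroupRep
        (((E.primaryTorsionGaloisRep p).restrict (localMap K (Sum.inl w)) :
        ContinuousRep (absoluteGaloisGroup (w.adicCompletion K)) ℤ_[p] (PrimaryTorsion (geomPoints E) p))).toTopRep (absInertia (w.adicCompletion K)))) ⧸ Submodule.torsion ℤ_[p] (CharacterModule (continuousCohomology 1 (subgroupRep
        (((E.primaryTorsionGaloisRep p).restrict (localMap K (Sum.inl w)) :
        ContinuousRep (absoluteGaloisGroup (w.adicCompletion K)) ℤ_[p] (PrimaryTorsion (geomPoints E) p))).toTopRep (absInertia (w.adicCompletion K)))))))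
    (hLt : ∀ χ, Lt (Submodule.Quotient.mk χ) = Submodule.Quotient.mk
      (CharacterModule.dual (conjMap (((E.primaryTorsionGaloisRep p).restrict (localMap K (Sum.inl w)) :
        ContinuousRep (absoluteGaloisGroup (w.adicCompletion K)) ℤ_[p] (PrimaryTorsion (geomPoints E) p))).toTopRep (absInertia (w.adicCompletion K)) φ 1).hom.toLinearMap χ)) :
    LinearMap.charpoly Lt = X - C ((↑n⁻¹ : ℤ_[p]) * ε) := by
  haveI : CompactSpace (absoluteGaloisGroup (w.adicCompletion K)) :=
    absoluteGaloisGroup_compactSpace (w.adicCompletion K)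
  haveI : CompactSpace (absInertia (w.adicCompletion K)) :=
    isCompact_iff_compactSpace.mp (isClosed_absInertia_holds (w.adicCompletion K)).isCompact
  have hℓ := w.ringChar_residueField_adicCompletion_ne hw
  have hA := primaryTorsion_exists_pow_nsmul_eq_zero E p
  have hfin := primaryTorsion_setOf_pow_nsmul_eq_zero_finite E p
  have hP : ∀ σ ∈ absInertia (w.adicCompletion K), ∀ a, ∃ k : ℕ, ((((E.primaryTorsionGaloisRep p).restrict (localMap K (Sum.inl w)) :
        ContinuousRep (absoluteGaloisGroup (w.adicCompletion K)) ℤ_[p] (PrimaryTorsion (geomPoints E) p)) σ) ^ p ^ k) a = a :=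
    fun σ hσ a => exists_pow_prime_pow_apply_eq_of_mem_absInertia E p hw hv hσ a
  -- `H` is `p`-primary
  have hA' : ∀ m : (subgroupRep (((E.primaryTorsionGaloisRep p).restrict (localMap K (Sum.inl w)) :
        ContinuousRep (absoluteGaloisGroup (w.adicCompletion K)) ℤ_[p] (PrimaryTorsion (geomPoints E) p))).toTopRep (absInertia (w.adicCompletion K))),
      ∃ k : ℕ, (p : ℤ_[p]) ^ k • m = 0 :=
    fun m => (hA m).imp fun k hk => by rw [← Nat.cast_pow, Nat.cast_smul_eq_nsmul]; exact hk
  have hB : ∀ b : (continuousCohomology 1 (subgroupRep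
        (((E.primaryTorsionGaloisRep p).restrict (localMap K (Sum.inl w)) :
        ContinuousRep (absoluteGaloisGroup (w.adicCompletion K)) ℤ_[p] (PrimaryTorsion (geomPoints E) p))).toTopRep (absInertia (w.adicCompletion K)))), ∃ k : ℕ, p ^ k • b = 0 := fun b =>
    (BigGaloisRep.exists_pow_smul_eq_zero _ (p : ℤ_[p]) hA' b).imp fun k hk => by
      rwa [← Nat.cast_pow, Nat.cast_smul_eq_nsmul] at hk
  -- the coinvariant evaluation isomorphism and its Frobenius clause (typer lane)
  obtain ⟨τ, hgen, -, hcoinv⟩ :=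
    exists_tame_generator_continuousCohomology_absInertia (w.adicCompletion K) hℓ
  obtain ⟨e, he⟩ := hcoinv ((E.primaryTorsionGaloisRep p).restrict (localMap K (Sum.inl w)) :
        ContinuousRep (absoluteGaloisGroup (w.adicCompletion K)) ℤ_[p] (PrimaryTorsion (geomPoints E) p)) hA hfin hP
  have hWD : LinearMap.range (((E.primaryTorsionGaloisRep p).restrict (localMap K (Sum.inl w)) :
        ContinuousRep (absoluteGaloisGroup (w.adicCompletion K)) ℤ_[p] (PrimaryTorsion (geomPoints E) p)) (τ : absoluteGaloisGroup (w.adicCompletion K)) - 1) = (Submodule.span ℤ_[p] {x : PrimaryTorsion (geomPoints E) p |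
        ∃ σ ∈ absInertia (w.adicCompletion K), ∃ a, x = ((E.primaryTorsionGaloisRep p).restrict (localMap K (Sum.inl w)) :
        ContinuousRep (absoluteGaloisGroup (w.adicCompletion K)) ℤ_[p] (PrimaryTorsion (geomPoints E) p)) σ a - a}) :=
    range_sub_one_eq_span (w.adicCompletion K) _ hA hfin hP hgen
  have hfrobW := fun c => residueFieldCard_nsmul_equiv_conjMap_coinvariants (w.adicCompletion K)
    ((E.primaryTorsionGaloisRep p).restrict (localMap K (Sum.inl w)) :
        ContinuousRep (absoluteGaloisGroup (w.adicCompletion K)) ℤ_[p] (PrimaryTorsion (geomPoints E) p)) hℓ hA hfin hP hgen hφ e he c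
  let e' : (continuousCohomology 1 (subgroupRep
        (((E.primaryTorsionGaloisRep p).restrict (localMap K (Sum.inl w)) :
        ContinuousRep (absoluteGaloisGroup (w.adicCompletion K)) ℤ_[p] (PrimaryTorsion (geomPoints E) p))).toTopRep (absInertia (w.adicCompletion K)))) ≃ₗ[ℤ_[p]] (PrimaryTorsion (geomPoints E) p ⧸ (Submodule.span ℤ_[p] {x : PrimaryTorsion (geomPoints E) p |
        ∃ σ ∈ absInertia (w.adicCompletion K), ∃ a, x = ((E.primaryTorsionGaloisRep p).restrict (localMap K (Sum.inl w)) :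
        ContinuousRep (absoluteGaloisGroup (w.adicCompletion K)) ℤ_[p] (PrimaryTorsion (geomPoints E) p)) σ a - a})) :=
    e.trans (Submodule.quotEquivOfEq _ _ hWD)
  have hfrob' : ∀ c : (continuousCohomology 1 (subgroupRep
        (((E.primaryTorsionGaloisRep p).restrict (localMap K (Sum.inl w)) :
        ContinuousRep (absoluteGaloisGroup (w.adicCompletion K)) ℤ_[p] (PrimaryTorsion (geomPoints E) p))).toTopRep (absInertia (w.adicCompletion K)))), residueFieldCard (w.adicCompletion K) •
      e' ((conjMap (((E.primaryTorsionGaloisRep p).restrict (localMap K (Sum.inl w)) :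
        ContinuousRep (absoluteGaloisGroup (w.adicCompletion K)) ℤ_[p] (PrimaryTorsion (geomPoints E) p))).toTopRep (absInertia (w.adicCompletion K)) φ 1).hom c) =
      (((E.primaryTorsionGaloisRep p).restrict (localMap K (Sum.inl w)) :
        ContinuousRep (absoluteGaloisGroup (w.adicCompletion K)) ℤ_[p] (PrimaryTorsion (geomPoints E) p))).quotient (Submodule.span ℤ_[p] {x : PrimaryTorsion (geomPoints E) p |
        ∃ σ ∈ absInertia (w.adicCompletion K), ∃ a, x = ((E.primaryTorsionGaloisRep p).restrict (localMap K (Sum.inl w)) :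
        ContinuousRep (absoluteGaloisGroup (w.adicCompletion K)) ℤ_[p] (PrimaryTorsion (geomPoints E) p)) σ a - a}) (coinvSpan_le_comap E p) φ (e' c) := by
    intro c
    change residueFieldCard (w.adicCompletion K) • Submodule.quotEquivOfEq _ _ hWD
        (e (conjMap (((E.primaryTorsionGaloisRep p).restrict (localMap K (Sum.inl w)) :
        ContinuousRep (absoluteGaloisGroup (w.adicCompletion K)) ℤ_[p] (PrimaryTorsion (geomPoints E) p))).toTopRep (absInertia (w.adicCompletion K)) φ 1 c)) =
      (((E.primaryTorsionGaloisRep p).restrict (localMap K (Sum.inl w)) :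
        ContinuousRep (absoluteGaloisGroup (w.adicCompletion K)) ℤ_[p] (PrimaryTorsion (geomPoints E) p))).quotient (Submodule.span ℤ_[p] {x : PrimaryTorsion (geomPoints E) p |
        ∃ σ ∈ absInertia (w.adicCompletion K), ∃ a, x = ((E.primaryTorsionGaloisRep p).restrict (localMap K (Sum.inl w)) :
        ContinuousRep (absoluteGaloisGroup (w.adicCompletion K)) ℤ_[p] (PrimaryTorsion (geomPoints E) p)) σ a - a}) (coinvSpan_le_comap E p) φ (Submodule.quotEquivOfEq _ _ hWD (e c))
    rw [← map_nsmul, hfrobW c]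
    induction e c using Submodule.Quotient.induction_on with
    | _ a =>
      rw [Submodule.mapQ_apply, Submodule.quotEquivOfEq_mk, Submodule.quotEquivOfEq_mk]
      exact (ContinuousRep.quotient_apply_mk _ _ _ φ a).symm
  -- Tate-module bridge
  rw [BigRepModule.charpoly_quotientTorsion_endo_dual_eq_charpoly_tateModule_map' hB _ Lt hLt]
  haveI hTf := TateModule.module_finite_of_module_finite_characterModule (p := p) (B := (continuousCohomology 1 (subgroupRep
        (((E.primaryTorsionGaloisRep p).restrict (localMap K (Sum.inl w)) :
        ContinuousRep (absoluteGaloisGroup (w.adicCompletion K)) ℤ_[p] (PrimaryTorsion (geomPoints E) p))).toTopRep (absInertia (w.adicCompletion K)))))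
  haveI hTfr := TateModule.module_free_of_module_finite_characterModule (p := p) (B := (continuousCohomology 1 (subgroupRep
        (((E.primaryTorsionGaloisRep p).restrict (localMap K (Sum.inl w)) :
        ContinuousRep (absoluteGaloisGroup (w.adicCompletion K)) ℤ_[p] (PrimaryTorsion (geomPoints E) p))).toTopRep (absInertia (w.adicCompletion K)))))
  let Φ : TateModule (continuousCohomology 1 (subgroupRep
        (((E.primaryTorsionGaloisRep p).restrict (localMap K (Sum.inl w)) :
        ContinuousRep (absoluteGaloisGroup (w.adicCompletion K)) ℤ_[p] (PrimaryTorsion (geomPoints E) p))).toTopRep (absInertia (w.adicCompletion K)))) p ≃ₗ[ℤ_[p]] TateModule (PrimaryTorsion (geomPoints E) p ⧸ (Submodule.span ℤ_[p] {x : PrimaryTorsion (geomPoints E) p |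
        ∃ σ ∈ absInertia (w.adicCompletion K), ∃ a, x = ((E.primaryTorsionGaloisRep p).restrict (localMap K (Sum.inl w)) :
        ContinuousRep (absoluteGaloisGroup (w.adicCompletion K)) ℤ_[p] (PrimaryTorsion (geomPoints E) p)) σ a - a})) p :=
    LinearEquiv.ofBijective (TateModule.map p e'.toAddEquiv.toAddMonoidHom)
      (tateModule_map_bijective_of_addEquiv e'.toAddEquiv)
  haveI : Module.Finite ℤ_[p] (TateModule (PrimaryTorsion (geomPoints E) p ⧸ (Submodule.span ℤ_[p] {x : PrimaryTorsion (geomPoints E) p |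
        ∃ σ ∈ absInertia (w.adicCompletion K), ∃ a, x = ((E.primaryTorsionGaloisRep p).restrict (localMap K (Sum.inl w)) :
        ContinuousRep (absoluteGaloisGroup (w.adicCompletion K)) ℤ_[p] (PrimaryTorsion (geomPoints E) p)) σ a - a})) p) := Module.Finite.equiv Φ
  haveI : Module.Free ℤ_[p] (TateModule (PrimaryTorsion (geomPoints E) p ⧸ (Submodule.span ℤ_[p] {x : PrimaryTorsion (geomPoints E) p |
        ∃ σ ∈ absInertia (w.adicCompletion K), ∃ a, x = ((E.primaryTorsionGaloisRep p).restrict (localMap K (Sum.inl w)) :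
        ContinuousRep (absoluteGaloisGroup (w.adicCompletion K)) ℤ_[p] (PrimaryTorsion (geomPoints E) p)) σ a - a})) p) := Module.Free.of_equiv Φ
  -- `T_p(φ·)` is the scalar `n⁻¹ ε`
  have hpt : ∀ t : TateModule (continuousCohomology 1 (subgroupRep
        (((E.primaryTorsionGaloisRep p).restrict (localMap K (Sum.inl w)) :
        ContinuousRep (absoluteGaloisGroup (w.adicCompletion K)) ℤ_[p] (PrimaryTorsion (geomPoints E) p))).toTopRep (absInertia (w.adicCompletion K)))) p,
      TateModule.map p (conjMap (((E.primaryTorsionGaloisRep p).restrict (localMap K (Sum.inl w)) :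
        ContinuousRep (absoluteGaloisGroup (w.adicCompletion K)) ℤ_[p] (PrimaryTorsion (geomPoints E) p))).toTopRep (absInertia (w.adicCompletion K)) φ 1).hom.toLinearMap.toAddMonoidHom t =
        ((↑n⁻¹ : ℤ_[p]) * ε) • t := by
    intro t
    have h1 : residueFieldCard (w.adicCompletion K) •
        Φ (TateModule.map p (conjMap (((E.primaryTorsionGaloisRep p).restrict (localMap K (Sum.inl w)) :
        ContinuousRep (absoluteGaloisGroup (w.adicCompletion K)) ℤ_[p] (PrimaryTorsion (geomPoints E) p))).toTopRep (absInertia (w.adicCompletion K)) φ 1).hom.toLinearMap.toAddMonoidHom t) =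
        TateModule.map p ((((E.primaryTorsionGaloisRep p).restrict (localMap K (Sum.inl w)) :
        ContinuousRep (absoluteGaloisGroup (w.adicCompletion K)) ℤ_[p] (PrimaryTorsion (geomPoints E) p))).quotient (Submodule.span ℤ_[p] {x : PrimaryTorsion (geomPoints E) p |
        ∃ σ ∈ absInertia (w.adicCompletion K), ∃ a, x = ((E.primaryTorsionGaloisRep p).restrict (localMap K (Sum.inl w)) :
        ContinuousRep (absoluteGaloisGroup (w.adicCompletion K)) ℤ_[p] (PrimaryTorsion (geomPoints E) p)) σ a - a}) (coinvSpan_le_comap E p) φ).toAddMonoidHom (Φ t) := by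
      refine TateModule.ext fun k => ?_
      rw [map_nsmul]
      change residueFieldCard (w.adicCompletion K) •
          TateModule.proj p k (TateModule.map p e'.toAddEquiv.toAddMonoidHom (TateModule.map p
            (conjMap (((E.primaryTorsionGaloisRep p).restrict (localMap K (Sum.inl w)) :
        ContinuousRep (absoluteGaloisGroup (w.adicCompletion K)) ℤ_[p] (PrimaryTorsion (geomPoints E) p))).toTopRep (absInertia (w.adicCompletion K)) φ 1).hom.toLinearMap.toAddMonoidHom t)) =
        TateModule.proj p k (TateModule.map p ((((E.primaryTorsionGaloisRep p).restrict (localMap K (Sum.inl w)) :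
        ContinuousRep (absoluteGaloisGroup (w.adicCompletion K)) ℤ_[p] (PrimaryTorsion (geomPoints E) p))).quotient (Submodule.span ℤ_[p] {x : PrimaryTorsion (geomPoints E) p |
        ∃ σ ∈ absInertia (w.adicCompletion K), ∃ a, x = ((E.primaryTorsionGaloisRep p).restrict (localMap K (Sum.inl w)) :
        ContinuousRep (absoluteGaloisGroup (w.adicCompletion K)) ℤ_[p] (PrimaryTorsion (geomPoints E) p)) σ a - a}) (coinvSpan_le_comap E p) φ).toAddMonoidHom
          (TateModule.map p e'.toAddEquiv.toAddMonoidHom t))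
      rw [TateModule.proj_map, TateModule.proj_map, TateModule.proj_map, TateModule.proj_map]
      exact hfrob' (TateModule.proj p k t)
    rw [tateModule_quotient_frob_eq E p hw hv hφ hε (Φ t)] at h1
    have h1' : Φ (residueFieldCard (w.adicCompletion K) • TateModule.map p (conjMap
        (((E.primaryTorsionGaloisRep p).restrict (localMap K (Sum.inl w)) :
          ContinuousRep (absoluteGaloisGroup (w.adicCompletion K)) ℤ_[p]
            (PrimaryTorsion (geomPoints E) p))).toTopRep (absInertia (w.adicCompletion K)) φ 1).hom.toLinearMap.toAddMonoidHom t) =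
        Φ (ε • t) := by
      rw [map_nsmul, map_smul]; exact h1
    have h2 := Φ.injective h1'
    rw [← Nat.cast_smul_eq_nsmul ℤ_[p], ← hn] at h2
    exact eq_unitsInv_mul_smul_of_units_smul_eq n ε _ t h2
  -- rank one and conclusion
  have h1 : Module.finrank ℤ_[p] (TateModule (continuousCohomology 1 (subgroupRep
        (((E.primaryTorsionGaloisRep p).restrict (localMap K (Sum.inl w)) :
        ContinuousRep (absoluteGaloisGroup (w.adicCompletion K)) ℤ_[p] (PrimaryTorsion (geomPoints E) p))).toTopRep (absInertia (w.adicCompletion K)))) p) = 1 := by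
    rw [Φ.finrank_eq]; exact finrank_tateModule_quotient_eq_one E p hw hv
  exact charpoly_eq_X_sub_C_of_forall_eq_smul h1 _ _ hpt

/-- **(S5) at a SPLIT multiplicative place ⇒ the Euler-factor membership of `hS5`**:
`eulerFactor p ℤ_[p] Nw .splitMult c ∈ ((charpoly Lt).reverse((1+T)^{−c}))`.
[cite: GreenbergVatsal2000, Prop. 2.4 and proof (arXiv p. 22)] [cite: Skinner2016PacificMC, §2.3 (p. 180)] -/
theorem eulerFactor_splitMult_mem_span
    (hw : ((p : ℕ) : 𝓞 K) ∉ w.asIdeal) (κ : ZpExtension K p) {Nw : ℕ} {c : ℤ_[p]}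
    (hdata : IsEulerDataAt E κ w Nw .splitMult c)
    {φ : absoluteGaloisGroup (w.adicCompletion K)} (hφ : IsFrobPow φ 1)
    [ContinuousSMul ℤ_[p] (PrimaryTorsion (geomPoints E) p)]
    [(absInertia (w.adicCompletion K)).Normal]
    [Module.Finite ℤ_[p] (CharacterModule (continuousCohomology 1 (subgroupRep
        (((E.primaryTorsionGaloisRep p).restrict (localMap K (Sum.inl w)) :
        ContinuousRep (absoluteGaloisGroup (w.adicCompletion K)) ℤ_[p] (PrimaryTorsion (geomPoints E) p))).toTopRep (absInertia (w.adicCompletion K)))))]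
    (Lt : (CharacterModule (continuousCohomology 1 (subgroupRep
        (((E.primaryTorsionGaloisRep p).restrict (localMap K (Sum.inl w)) :
        ContinuousRep (absoluteGaloisGroup (w.adicCompletion K)) ℤ_[p] (PrimaryTorsion (geomPoints E) p))).toTopRep (absInertia (w.adicCompletion K)))) ⧸ Submodule.torsion ℤ_[p] (CharacterModule (continuousCohomology 1 (subgroupRep
        (((E.primaryTorsionGaloisRep p).restrict (localMap K (Sum.inl w)) :
        ContinuousRep (absoluteGaloisGroup (w.adicCompletion K)) ℤ_[p] (PrimaryTorsion (geomPoints E) p))).toTopRep (absInertia (w.adicCompletion K)))))) →ₗ[ℤ_[p]]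
      (CharacterModule (continuousCohomology 1 (subgroupRep
        (((E.primaryTorsionGaloisRep p).restrict (localMap K (Sum.inl w)) :
        ContinuousRep (absoluteGaloisGroup (w.adicCompletion K)) ℤ_[p] (PrimaryTorsion (geomPoints E) p))).toTopRep (absInertia (w.adicCompletion K)))) ⧸ Submodule.torsion ℤ_[p] (CharacterModule (continuousCohomology 1 (subgroupRep
        (((E.primaryTorsionGaloisRep p).restrict (localMap K (Sum.inl w)) :
        ContinuousRep (absoluteGaloisGroup (w.adicCompletion K)) ℤ_[p] (PrimaryTorsion (geomPoints E) p))).toTopRep (absInertia (w.adicCompletion K)))))))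
    (hLt : ∀ χ, Lt (Submodule.Quotient.mk χ) = Submodule.Quotient.mk
      (CharacterModule.dual (conjMap (((E.primaryTorsionGaloisRep p).restrict (localMap K (Sum.inl w)) :
        ContinuousRep (absoluteGaloisGroup (w.adicCompletion K)) ℤ_[p] (PrimaryTorsion (geomPoints E) p))).toTopRep (absInertia (w.adicCompletion K)) φ 1).hom.toLinearMap χ)) :
    eulerFactor p ℤ_[p] Nw .splitMult c ∈
      Ideal.span {Polynomial.aeval (BigRepModule.binomSeries ℤ_[p] (-c)) (LinearMap.charpoly Lt).reverse} := by
  obtain ⟨hNw, -, hsp⟩ := hdata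
  obtain ⟨n, hn⟩ := isUnit_residueFieldCard_padicInt (K := K) (w := w) hw
  refine eulerFactor_splitMult_mem_span_of_charpoly_eq Lt Nw c n ?_ ?_
  · rw [hn, hNw, residueFieldCard_eq_absNorm]
  · rw [charpoly_quotientTorsion_dual_eq_of_hasMultiplicativeReductionAt E p hw hsp.hasMultiplicativeReductionAt
      hφ (Or.inl ⟨hsp, rfl⟩) n hn Lt hLt, mul_one]

/-- **(S5) at a NON-SPLIT multiplicative place ⇒ the Euler-factor membership of `hS5`**:
`eulerFactor p ℤ_[p] Nw .nonsplitMult c ∈ ((charpoly Lt).reverse((1+T)^{−c}))`.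
[cite: GreenbergVatsal2000, Prop. 2.4 and proof (arXiv p. 22)] [cite: Skinner2016PacificMC, §2.3 (p. 180)] -/
theorem eulerFactor_nonsplitMult_mem_span
    (hw : ((p : ℕ) : 𝓞 K) ∉ w.asIdeal) (κ : ZpExtension K p) {Nw : ℕ} {c : ℤ_[p]}
    (hdata : IsEulerDataAt E κ w Nw .nonsplitMult c)
    {φ : absoluteGaloisGroup (w.adicCompletion K)} (hφ : IsFrobPow φ 1)
    [ContinuousSMul ℤ_[p] (PrimaryTorsion (geomPoints E) p)]
    [(absInertia (w.adicCompletion K)).Normal]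
    [Module.Finite ℤ_[p] (CharacterModule (continuousCohomology 1 (subgroupRep
        (((E.primaryTorsionGaloisRep p).restrict (localMap K (Sum.inl w)) :
        ContinuousRep (absoluteGaloisGroup (w.adicCompletion K)) ℤ_[p] (PrimaryTorsion (geomPoints E) p))).toTopRep (absInertia (w.adicCompletion K)))))]
    (Lt : (CharacterModule (continuousCohomology 1 (subgroupRep
        (((E.primaryTorsionGaloisRep p).restrict (localMap K (Sum.inl w)) :
        ContinuousRep (absoluteGaloisGroup (w.adicCompletion K)) ℤ_[p] (PrimaryTorsion (geomPoints E) p))).toTopRep (absInertia (w.adicCompletion K)))) ⧸ Submodule.torsion ℤ_[p] (CharacterModule (continuousCohomology 1 (subgroupRep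
        (((E.primaryTorsionGaloisRep p).restrict (localMap K (Sum.inl w)) :
        ContinuousRep (absoluteGaloisGroup (w.adicCompletion K)) ℤ_[p] (PrimaryTorsion (geomPoints E) p))).toTopRep (absInertia (w.adicCompletion K)))))) →ₗ[ℤ_[p]]
      (CharacterModule (continuousCohomology 1 (subgroupRep
        (((E.primaryTorsionGaloisRep p).restrict (localMap K (Sum.inl w)) :
        ContinuousRep (absoluteGaloisGroup (w.adicCompletion K)) ℤ_[p] (PrimaryTorsion (geomPoints E) p))).toTopRep (absInertia (w.adicCompletion K)))) ⧸ Submodule.torsion ℤ_[p] (CharacterModule (continuousCohomology 1 (subgroupRep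
        (((E.primaryTorsionGaloisRep p).restrict (localMap K (Sum.inl w)) :
        ContinuousRep (absoluteGaloisGroup (w.adicCompletion K)) ℤ_[p] (PrimaryTorsion (geomPoints E) p))).toTopRep (absInertia (w.adicCompletion K)))))))
    (hLt : ∀ χ, Lt (Submodule.Quotient.mk χ) = Submodule.Quotient.mk
      (CharacterModule.dual (conjMap (((E.primaryTorsionGaloisRep p).restrict (localMap K (Sum.inl w)) :
        ContinuousRep (absoluteGaloisGroup (w.adicCompletion K)) ℤ_[p] (PrimaryTorsion (geomPoints E) p))).toTopRep (absInertia (w.adicCompletion K)) φ 1).hom.toLinearMap χ)) :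
    eulerFactor p ℤ_[p] Nw .nonsplitMult c ∈
      Ideal.span {Polynomial.aeval (BigRepModule.binomSeries ℤ_[p] (-c)) (LinearMap.charpoly Lt).reverse} := by
  obtain ⟨hNw, -, hm, hns⟩ := hdata
  obtain ⟨n, hn⟩ := isUnit_residueFieldCard_padicInt (K := K) (w := w) hw
  refine eulerFactor_nonsplitMult_mem_span_of_charpoly_eq Lt Nw c n ?_ ?_
  · rw [hn, hNw, residueFieldCard_eq_absNorm]
  · rw [charpoly_quotientTorsion_dual_eq_of_hasMultiplicativeReductionAt E p hw hm hφ (Or.inr ⟨hns, rfl⟩) n hn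
      Lt hLt, mul_neg_one, map_neg, sub_neg_eq_add]

end Mult

end Summit.BirchSwinnertonDyer.BirchSwinnertonDyer.Theorems.SigmaLocal

end
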